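import Literature.MathematicalPhysics.QuantumFieldTheory.Balaban1983to89.T4InputCauchyRateData
import Literature.MathematicalPhysics.QuantumFieldTheory.Balaban1983to89.T4TwoRunMatching

/-!
# NE4TwoRunStepModel — binder row NE4 (spine node U2), technique P2 «two-trajectory comparison at spacings ε vs ε/L»:
# the two-run route's END WIRED ONTO ROW NE5's TYPED ONE-STEP OBJECTS (`T4InputCauchyRateData.StepModel`) AT TWO
# COUPLING HISTORIES — skeleton `HOME/t4/skeletons/NE4-t4-ne4-p2.md` §5b («BY-NAME MAP onto row NE5's typed objects»)
# made a kernel theorem (cell `pub-balaban`, T⁴-continuum fan-out, `HOME/BINDER-OWNERS.md` row NE4, co-owner seat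
# t4-ne4-p2, gen 19).

HONEST FRAMING (T4-DAG PAGE 1).  The cell's T⁴ target is rung (B)+1: existence AND uniqueness of the ε → 0 limit of
gauge-invariant observables on a FIXED finite torus T⁴ — NOT infinite volume, NOT a mass gap, NOT the Clay problem.  The
spine estimate NE4 («η-rate of the full β_k») is NOT PRINTED in [Balaban1987RG1]–[Balaban1989LargeFieldII] and is NOT PROVED
here.  This module ASSERTS NOTHING about Bałaban's effective actions: `StepModel` (row NE5's module `T4InputCauchyRateData`)
is HYPOTHESIS-CARRYING DATA, every `def … : Prop` below is a HYPOTHESIS SHAPE over it (consumed only as a binder, asserted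
nowhere), and every theorem is kernel-checked real bookkeeping (two triangle inequalities per data species, one induction on
the scale, two geometric identities).  CONDITIONALS BY NAME, never hidden: (AF-0r) is the binder `hconv` (field `conv` of the
β sub-cell's `Beta.Assembly.LimitForm`, member of `FlowStep.BetaPertH`, NOT discharged for Bałaban's β); the infrared-pinned
runs inside the box (node U1/H3; (B)/(B^μ) live there) are the binders `hrun`/`hbox`/`hpin`; row NE5's walls
(`DataLipschitz` = GAPS G-ne5p1-1′/1″, `OperatorRate` = MI-1 ⇐ rows NE2/NE3, `InsertionRate`, `InsertionDamped` = MI-3a)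
are binders BY NAME; the β read-out (R) is the binder `TwoRunReadOutModel` (GAPS G-ne4p2-2 in model currency).
HONEST DEPENDENCY (cell, verbatim): continuum YM on T⁴ ⇐ BetaPertH ∧ nine spine estimates (0/9 proved); BetaPertH ⇐ (D1) ∧
(D4) ∧ CAP+tail; G-an2-4 gates asym, D1 and NE2/3/4.  VALUE = kernel bookkeeping: WHICH one-step shapes the two-run route
consumes, BY NAME; NOT an estimate on Bałaban's (2.13), NOT summit progress.

WHAT ROW NE5's MODULE TYPES, AND WHAT THIS ONE ADDS.  `T4InputCauchyRateData.StepModel C Op Hist` is ONE analytic step map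
`Out k : Op → Hist → Dom → ℂ` read by BOTH runs (run A = K steps from ε, run B = K + 1 steps from ε/L; [Balaban1988RG2Cluster]
(1.5) p. 3: «the functional depends on its input operators only through their bounds» — the two spacings differ in the DATA),
the runs' operator data `opA/opB g U k`, their history insertions `insA/insB g U k (table)`, and the walls
`RepresentsA/B` (the run IS the orbit of its data maps), `DataLipschitz κ Λ ρ₀` (two-point Lipschitz bound of the one step in
margin units), `OperatorRate δ θ`, `InsertionRate κ E₀ δ′ θ`, `InsertionDamped κ c ω` (damped-Lipschitz insertion with the
printed age factor ω^{k−j}, [Balaban1988RG2Cluster] (1.24) p. 7 / p. 8 «the factor L^jη, which controls the sum over j»).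
There the two runs are compared AT ONE COUPLING SEQUENCE `g` («the marginal (β-function) channel has NO damping and is NOT
covered by this shape: it is node U2's (NE4)», docstring of `InsertionDamped`).  THIS module compares run A at history `gA`
with run B at history `gB` (in the spine: `gA = g K`, `gB = fun i ↦ g (K+1) (i+1)`, the two infrared-pinned runs of (0.20)
re-indexed so that partnered steps share the creation scale) and adds exactly TWO one-step shapes of row-NE9 TYPE for the
explicit coupling of the step — `CouplingDataOp ℓop`, `CouplingDataIns κ E₀ ℓins`: the data creating the scale-k terms are
Lipschitz in the coupling coordinate `k − 1` ([Balaban1987RG1] (1.7) p. 261 «E^{(j)}(g_{j−1}, U_j)», (2.12)–(2.13) p. 268: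
the step producing E^{(k+1)} carries g_k explicitly — in the scaling B = g_kB′, in P^{(k)}(g_k, ·), in χ_k — and the earlier
couplings only through the previous actions, i.e. through the TABLE; row NE9's `NE9LastCouplingBridge` types the same
last-coupling clause `hCup`/`hTcup` for one run) — and the β read-out in model currency, `TwoRunReadOutModel S r`
([Balaban1987RG1] (1.20)–(1.22) p. 264: β_{j+1} is a fixed second-moment functional of the scale-(j+1) term; the binder says
the β¹-mismatch of the partnered steps is `r`-dominated by ANY weighted-sup majorant of the scale-(j+1) two-run output
discrepancy — the row owner's `T4BetaReadOutLipschitz.ReadCovariantOn` in two-run form; the number `r` is NOT PRINTED, GAPS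
G-t4-U3-2/(C5)).

CONTENT.  §1 the two-history discrepancy `disc₂`, its scale slices and the TWO-HISTORY RECURSIVE BUDGET `RecursiveRate₂ EA EB gA
gB κ θ ω A ℓ b` (row NE5's `T4InputCauchyRate.RecursiveRate` plus the coupling term `ℓ·|gA (k−1) − gB (k−1)|`); the two
coupling-data shapes; the read-out binder.  §2 **`recursiveRate₂_of_stepModel_lip`**: row NE5's `recursiveRate_of_stepModel_lip`
RE-RUN AT TWO HISTORIES — same proof, one more triangle inequality per species (operators: `opA gA → opA gB → opB gB`;
histories: `insA gA tabA → insA gA tabB → insA gB tabB → insB gB tabB`), constants `A = Λ(δ + δ′) + B`, `ℓ = Λ(ℓop + ℓins)`,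
`b = Λc`, near hypothesis enlarged by `(ℓop + ℓins)·Γ` (`Γ` = a bound on the coordinatewise distance of the two histories).
The CLOSURE of the budget (explicit majorant `cl`), its IDENTIFICATION with the channel shapes of `NE4TwoRunChannelsWeighted`
(`BirthChannelsW K ℓ (bω) ω` with EQUALITY, `TransportLaw K 1 e 0`, `BirthProjection K 1 b 0 e`) and the END
**`injectedRate_of_stepModel₂`** (node U2's spine binder `T4CauchySum.InjectedRate` LITERALLY from the StepModel shapes at the pairs
of histories `(g K, shifted g (K+1))`, memory GAP `ω·(1 + Λc) < ρ`) are in the companion module `NE4TwoRunStepModelEnd` (the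
400-line rule).

WHAT IS NEW / NOT PRINTED (leaf status, skeleton §3): `CouplingDataOp`/`CouplingDataIns` = leaf L8 (TYPE: printed qualitative
smoothness in g_k, [Balaban1987RG1] p. 264 / p. 266 bottom; numbers ℓop, ℓins unprinted, cell GAPS G-b12-2); `DataLipschitz` =
leaves L7 (operator half) + L9b (history half = G-b12g8-1 = G-ne5p1-1″-hist); `InsertionDamped` = L9a (printed age factor,
one run; on differences = MI-3a); `OperatorRate`/`InsertionRate` = rows NE2/NE3 by name (MI-1, G-ne5p1-4); `TwoRunReadOutModel`
= L4–L6.  No leaf states a rate for β, β¹, δ or b: the rate ρ^j is manufactured by `T4TwoRunMatching.twoPoint_fixedPoint`.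
Module of unit `b2b-balaban-t4-ne4-p2` (gen 19); imports row NE5's `T4InputCauchyRateData` and this lineage's root `T4TwoRunMatching`
(both Literature) and modifies nothing; no `sorry`, no `axiom`.
-/

namespace Summit.QuantumFields.BalabanUV.T4Continuum.NE4TwoRunStepModel

open Literature.MathematicalPhysics.QuantumFieldTheory.Balaban1983to89
open T4OutputRate (Carriers Functional DecayBound)
open T4InputCauchyRateData (StepModel tableA tableB sum_pow_age_le)
open FlowStep (HBeta RGEqH)
open T4TwoRunMatching (remMismatch)
open Metric Set Finset

/-! ## §1 Two-history discrepancy, its recursive budget, and the three binders this route adds to row NE5's list -/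

section TwoHistory

variable {C : Carriers}

/-- The TWO-HISTORY two-run output discrepancy at `(U, X)`: run A's scale-`scale X` term at coupling history `gA`, read at the
transported background, against run B's at history `gB` — the quantity whose scale-(j+1) slice the β read-out of the partnered
steps sees.  Row NE5's `T4InputCauchyRate.disc` is the diagonal `gA = gB`. [folklore] -/
def disc₂ (EA : Functional C C.BgA) (EB : Functional C C.BgB) (gA gB : ℕ → ℝ) (U : C.BgB) (X : C.Dom) : ℝ :=
  |EA gA (C.transport U) X - EB gB U X|

/-- `disc₂ ≥ 0`. [folklore] -/
theorem disc₂_nonneg (EA : Functional C C.BgA) (EB : Functional C C.BgB) (gA gB : ℕ → ℝ) (U : C.BgB) (X : C.Dom) :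
    0 ≤ disc₂ EA EB gA gB U X := abs_nonneg _

/-- The scale-`j` SLICE bound of the pair of runs `(gA, gB)` with constant `D`: at every background and every domain created
at step `j`, `disc₂ ≤ D·e^{−κ d(X)}`. [folklore] -/
def BoundedAtScale₂ (EA : Functional C C.BgA) (EB : Functional C C.BgB) (gA gB : ℕ → ℝ) (κ : ℝ) (j : ℕ) (D : ℝ) :
    Prop :=
  ∀ (U : C.BgB) (X : C.Dom), C.scale X = j → disc₂ EA EB gA gB U X ≤ D * Real.exp (-(κ * C.d X))

/-- A larger constant is still a slice bound. [folklore] -/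
theorem boundedAtScale₂_mono {EA : Functional C C.BgA} {EB : Functional C C.BgB} {gA gB : ℕ → ℝ} {κ : ℝ} {j : ℕ}
    {D D' : ℝ} (h : BoundedAtScale₂ EA EB gA gB κ j D) (hD : D ≤ D') : BoundedAtScale₂ EA EB gA gB κ j D' :=
  fun U X hX => (h U X hX).trans (mul_le_mul_of_nonneg_right hD (Real.exp_pos _).le)

/-- HYPOTHESIS SHAPE (NOT PRINTED; the conclusion shape of §2, asserted nowhere): the TWO-HISTORY RECURSIVE BUDGET of the pair
of runs `(gA, gB)` with artifact rate `θ`, age factor `ω`, source constant `A`, COUPLING MODULUS `ℓ` and history constant `b`: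
whatever nonnegative constants `D_j` majorise the pair's slices at the scales `j < k`, the scale-`k` slice is majorised by
`Aθ^k + ℓ·|gA (k−1) − gB (k−1)| + Σ_{j<k} bω^{k−j}D_j` — row NE5's `RecursiveRate` plus the channel of the step's explicit
coupling `g_{k−1}` ([Balaban1987RG1] (1.7): E^{(k)}(g_{k−1}, ·); natural subtraction: at `k = 0` the clause allows a
dependence on the coordinate 0, an over-generous allowance — the starting action carries no irrelevant terms). [folklore] -/
def RecursiveRate₂ (EA : Functional C C.BgA) (EB : Functional C C.BgB) (gA gB : ℕ → ℝ) (κ θ ω A ℓ b : ℝ) : Prop :=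
  ∀ (k : ℕ) (D : ℕ → ℝ), (∀ j < k, 0 ≤ D j ∧ BoundedAtScale₂ EA EB gA gB κ j (D j)) →
    BoundedAtScale₂ EA EB gA gB κ k
      (A * θ ^ k + ℓ * |gA (k - 1) - gB (k - 1)| + ∑ j ∈ range k, b * ω ^ (k - j) * D j)

/-- HYPOTHESIS SHAPE `TwoRunReadOutModel S r` — the β READ-OUT (R) IN MODEL CURRENCY (NOT PRINTED as a bound; printed
structure [Balaban1987RG1] (1.20)–(1.22) p. 264: β_{j+1}(g_j) is the second moment of the B = 0 Hessian kernel of the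
scale-(j+1) term composed with the run's minimizer — ONE linear functional, the same recipe for both runs on the same coarse
lattice): along the pair of runs (run A at history `gA`, K steps; run B at history `gB`, K + 1 steps; partnered steps A-(j+1)
↔ B-(j+2) create the scale-(j+1) terms, read at the histories `gA` and `fun i ↦ gB (i+1)`), the β¹-MISMATCH
`T4TwoRunMatching.remMismatch S gA gB j` is at most `r ×` ANY constant majorising the scale-(j+1) two-run output slice.  The
row owner's `T4BetaReadOutLipschitz.ReadCovariantOn` in two-run form; `r` per unit volume (GAPS G-t4-U3-2, convention (C5)).
[folklore] -/
def TwoRunReadOutModel {β : HBeta} (S : B12Beta.OneLoopSplit β) (r : ℝ) (EA : Functional C C.BgA)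
    (EB : Functional C C.BgB) (κ : ℝ) (gA gB : ℕ → ℝ) (K : ℕ) : Prop :=
  ∀ j, j < K → ∀ D : ℝ, 0 ≤ D → BoundedAtScale₂ EA EB gA (fun i => gB (i + 1)) κ (j + 1) D →
    remMismatch S gA gB j ≤ r * D

end TwoHistory

section Model

variable {C : Carriers} {Op Hist : Type*} [NormedAddCommGroup Op] [NormedSpace ℂ Op] [NormedAddCommGroup Hist]
  [NormedSpace ℂ Hist]

/-- HYPOTHESIS SHAPE `CouplingDataOp ℓop` (NOT PRINTED as a bound; printed TYPE: the step creating the scale-`k` terms carries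
the coupling `g_{k−1}` explicitly and smoothly — [Balaban1987RG1] (2.12) p. 268 (scaling B = g_kB′, exponent P^{(k)}(g_k, ·),
indicator χ_k), p. 264 «smooth function … (or analytic)», p. 266 bottom «analytic functions of the effective coupling
constants»; the number is cell GAPS G-b12-2): on the window `W`, run A's OPERATOR data at step `k` at two coupling histories
differ by at most `ℓop·|g (k−1) − g′ (k−1)|` operator margins.  Row-NE9 type (last-coupling clause `hCup`/`hTcup` of
`NE9LastCouplingBridge`), here for the data maps of row NE5's model. [folklore] -/
def CouplingDataOp (M : StepModel C Op Hist) (W : Set (ℕ → ℝ)) (ℓop : ℝ) : Prop :=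
  ∀ k, ∀ g ∈ W, ∀ g' ∈ W, ∀ (U : C.BgB), ‖M.opA g U k - M.opA g' U k‖ ≤ ℓop * |g (k - 1) - g' (k - 1)| * M.rOp k

/-- HYPOTHESIS SHAPE `CouplingDataIns κ E₀ ℓins` (NOT PRINTED as a bound; printed TYPE as for `CouplingDataOp`: the old action
enters (2.12) through the curly bracket «{E_k(U_k(exp i[g_kCB − hD̃(g_kCB)]V^{(k)})) − E_k(U_k(V^{(k)}))}», p. 268, whose explicit
coupling is g_k; the earlier couplings sit inside E_k, i.e. in the TABLE): on every table obeying the one-run decay bound, run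
A's HISTORY INSERTION at step `k` at two coupling histories differs by at most `ℓins·|g (k−1) − g′ (k−1)|` history margins.
[folklore] -/
def CouplingDataIns (M : StepModel C Op Hist) (W : Set (ℕ → ℝ)) (κ E₀ ℓins : ℝ) : Prop :=
  ∀ k, ∀ g ∈ W, ∀ g' ∈ W, ∀ (U : C.BgB) (t : C.Dom → ℝ), (∀ Y, |t Y| ≤ E₀ * Real.exp (-(κ * C.d Y))) →
    ‖M.insA g U k t - M.insA g' U k t‖ ≤ ℓins * |g (k - 1) - g' (k - 1)| * M.rHist k

/-! ## §2 The one step at two histories: row NE5's recursion re-run with the coupling channel -/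

/-- **THE STEP AT TWO HISTORIES.**  Row NE5's `recursiveRate_of_stepModel_lip` RE-RUN for run A at history `gA` and run B at
history `gB` (both in the window `W`, coordinatewise `Γ`-close): representation of the two runs, admissibility of run B's data,
the two-point wall `DataLipschitz κ Λ ρ₀`, the one-run decay bounds (levels `EA₀`, `E₀`), `OperatorRate δ θ`, `InsertionRate κ E₀
δ′ θ`, `InsertionDamped κ c ω` — ALL BY NAME from `T4InputCauchyRateData` — plus the two coupling-data shapes of §1, the near
hypothesis `(δ + δ′)θ^{k₀} + c(EA₀ + E₀)ω/(1 − ω) + (ℓop + ℓins)Γ ≤ ρ₀` and the first-scales bound `EA₀ + E₀ ≤ Bθ^k (k < k₀)`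
⟹ `RecursiveRate₂ EA EB gA gB κ θ ω (Λ(δ + δ′) + B) (Λ(ℓop + ℓins)) (Λc)`.  At a domain `X` of scale `k`: operator
discrepancy `≤ (ℓop·Δ + δθ^k)` margins (`opA gA → opA gB → opB gB`, `Δ = |gA (k−1) − gB (k−1)|`), history discrepancy
`≤ (cΣ_{j<k}ω^{k−j}D′_j + ℓins·Δ + δ′θ^k)` margins (`insA gA` between the two runs' tables — their scale-`j` difference is the
inherited two-history discrepancy, capped by the one-run levels — then `insA gA → insA gB` at run B's table, then `insA gB →
insB gB`); in the near regime the data-Lipschitz bound at run B's admissible datum applies, in the first scales the one-run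
bounds are absorbed by `B`.  Elementary; nothing of [Balaban1987RG1] is asserted. [folklore] -/
theorem recursiveRate₂_of_stepModel_lip (M : StepModel C Op Hist) {EA : Functional C C.BgA} {EB : Functional C C.BgB}
    {W : Set (ℕ → ℝ)} {gA gB : ℕ → ℝ} (hgA : gA ∈ W) (hgB : gB ∈ W)
    {κ Λ EA₀ E₀ δ δ' θ c ω ρ₀ B ℓop ℓins Γ : ℝ} {k₀ : ℕ}
    (hrA : M.RepresentsA EA W) (hrB : M.RepresentsB EB W) (hbase : M.InBase EB W) (hlip : M.DataLipschitz W κ Λ ρ₀)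
    (hdA : DecayBound EA W EA₀ κ) (hdB : DecayBound EB W E₀ κ) (hop : M.OperatorRate W δ θ)
    (hins : M.InsertionRate W κ E₀ δ' θ) (hdamp : M.InsertionDamped W κ c ω)
    (hcop : CouplingDataOp M W ℓop) (hcins : CouplingDataIns M W κ E₀ ℓins) (hΓ : ∀ i, |gA i - gB i| ≤ Γ)
    (hΛ : 0 ≤ Λ) (hδ : 0 ≤ δ + δ') (hθ : 0 ≤ θ) (hθ1 : θ ≤ 1) (hc : 0 ≤ c) (hω : 0 ≤ ω) (hω1 : ω < 1)
    (hℓ : 0 ≤ ℓop + ℓins)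
    (hnear : (δ + δ') * θ ^ k₀ + c * (EA₀ + E₀) * (ω / (1 - ω)) + (ℓop + ℓins) * Γ ≤ ρ₀) (hB : 0 ≤ B)
    (hfirst : ∀ k < k₀, EA₀ + E₀ ≤ B * θ ^ k) :
    RecursiveRate₂ EA EB gA gB κ θ ω (Λ * (δ + δ') + B) (Λ * (ℓop + ℓins)) (Λ * c) := by
  intro k D hD U X hX
  -- the two data points (run B at history gB = the base point; run A at history gA)
  set x₀ := M.opB gB U k with hx₀
  set x₁ := M.opA gA U k with hx₁
  set y₀ := M.insB gB U k (tableB EB gB U) with hy₀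
  set y₁ := M.insA gA U k (tableA EA gA U) with hy₁
  set Δ := |gA (k - 1) - gB (k - 1)| with hΔ_def
  have hΔ0 : 0 ≤ Δ := abs_nonneg _
  have hΔΓ : Δ ≤ Γ := hΓ (k - 1)
  have hrOp := M.rOp_pos k
  have hrHist := M.rHist_pos k
  have hexp := Real.exp_pos (-(κ * C.d X))
  have hθk : 0 ≤ θ ^ k := pow_nonneg hθ k
  -- the one-run levels are nonnegative (read at the point at hand)
  have hEA₀ : 0 ≤ EA₀ := by
    by_contra hneg
    have : EA₀ * Real.exp (-(κ * C.d X)) < 0 := mul_neg_of_neg_of_pos (not_le.mp hneg) hexp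
    linarith [abs_nonneg (EA gA (C.transport U) X), hdA gA hgA (C.transport U) X]
  have hE₀ : 0 ≤ E₀ := by
    by_contra hneg
    have : E₀ * Real.exp (-(κ * C.d X)) < 0 := mul_neg_of_neg_of_pos (not_le.mp hneg) hexp
    linarith [abs_nonneg (EB gB U X), hdB gB hgB U X]
  -- the inherited levels, and the CAPPED levels `min (D j) (EA₀ + E₀)`
  set S := ∑ j ∈ range k, ω ^ (k - j) * D j with hS
  set S' := ∑ j ∈ range k, ω ^ (k - j) * min (D j) (EA₀ + E₀) with hS'
  have hD'0 : ∀ j < k, 0 ≤ min (D j) (EA₀ + E₀) := fun j hj => le_min (hD j hj).1 (add_nonneg hEA₀ hE₀)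
  have hS'0 : 0 ≤ S' := sum_nonneg fun j hj => mul_nonneg (pow_nonneg hω _) (hD'0 j (mem_range.1 hj))
  have hS'S : S' ≤ S :=
    sum_le_sum fun j hj => mul_le_mul_of_nonneg_left (min_le_left _ _) (pow_nonneg hω _)
  have hS'E : S' ≤ (EA₀ + E₀) * (ω / (1 - ω)) :=
    calc S' ≤ ∑ j ∈ range k, ω ^ (k - j) * (EA₀ + E₀) :=
          sum_le_sum fun j hj => mul_le_mul_of_nonneg_left (min_le_right _ _) (pow_nonneg hω _)
      _ = (EA₀ + E₀) * ∑ j ∈ range k, ω ^ (k - j) := by rw [mul_sum]; exact sum_congr rfl fun j _ => mul_comm _ _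
      _ ≤ (EA₀ + E₀) * (ω / (1 - ω)) := mul_le_mul_of_nonneg_left (sum_pow_age_le hω hω1 k) (add_nonneg hEA₀ hE₀)
  -- every earlier TWO-HISTORY table discrepancy is bounded by the inherited level AND by the one-run levels
  have htab : ∀ Y, C.scale Y < k →
      |tableA EA gA U Y - tableB EB gB U Y| ≤ min (D (C.scale Y)) (EA₀ + E₀) * Real.exp (-(κ * C.d Y)) := by
    intro Y hY
    rw [min_mul_of_nonneg _ _ (Real.exp_pos _).le]
    refine le_min ((hD (C.scale Y) hY).2 U Y rfl) ?_
    calc |tableA EA gA U Y - tableB EB gB U Y| ≤ |tableA EA gA U Y| + |tableB EB gB U Y| := abs_sub _ _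
      _ ≤ EA₀ * Real.exp (-(κ * C.d Y)) + E₀ * Real.exp (-(κ * C.d Y)) :=
          add_le_add (hdA gA hgA _ Y) (hdB gB hgB U Y)
      _ = (EA₀ + E₀) * Real.exp (-(κ * C.d Y)) := by ring
  -- run B's table obeys the one-run decay bound
  have htB : ∀ Y, |tableB EB gB U Y| ≤ E₀ * Real.exp (-(κ * C.d Y)) := fun Y => hdB gB hgB U Y
  -- OPERATOR discrepancy in margin units: coupling channel + MI-1
  have hxd : ‖x₁ - x₀‖ ≤ (ℓop * Δ + δ * θ ^ k) * M.rOp k :=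
    calc ‖x₁ - x₀‖ ≤ ‖x₁ - M.opA gB U k‖ + ‖M.opA gB U k - x₀‖ := norm_sub_le_norm_sub_add_norm_sub _ _ _
      _ ≤ ℓop * Δ * M.rOp k + δ * θ ^ k * M.rOp k := add_le_add (hcop k gA hgA gB hgB U) (hop k gB hgB U)
      _ = (ℓop * Δ + δ * θ ^ k) * M.rOp k := by ring
  -- HISTORY discrepancy: memory (capped levels) + coupling channel + insertion rate
  have hdamp' : ‖y₁ - M.insA gA U k (tableB EB gB U)‖ ≤ M.rHist k * (c * S') :=
    hdamp k gA hgA U (tableA EA gA U) (tableB EB gB U) (fun j => min (D j) (EA₀ + E₀)) hD'0 htab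
  have hcins' : ‖M.insA gA U k (tableB EB gB U) - M.insA gB U k (tableB EB gB U)‖ ≤ ℓins * Δ * M.rHist k :=
    hcins k gA hgA gB hgB U (tableB EB gB U) htB
  have hins' : ‖M.insA gB U k (tableB EB gB U) - y₀‖ ≤ δ' * θ ^ k * M.rHist k := hins k gB hgB U (tableB EB gB U) htB
  have hyd : ‖y₁ - y₀‖ ≤ (c * S' + ℓins * Δ + δ' * θ ^ k) * M.rHist k :=
    calc ‖y₁ - y₀‖ ≤ ‖y₁ - M.insA gA U k (tableB EB gB U)‖
          + ‖M.insA gA U k (tableB EB gB U) - y₀‖ := norm_sub_le_norm_sub_add_norm_sub _ _ _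
      _ ≤ ‖y₁ - M.insA gA U k (tableB EB gB U)‖
          + (‖M.insA gA U k (tableB EB gB U) - M.insA gB U k (tableB EB gB U)‖
            + ‖M.insA gB U k (tableB EB gB U) - y₀‖) :=
          add_le_add le_rfl (norm_sub_le_norm_sub_add_norm_sub _ _ _)
      _ ≤ M.rHist k * (c * S') + (ℓins * Δ * M.rHist k + δ' * θ ^ k * M.rHist k) :=
          add_le_add hdamp' (add_le_add hcins' hins')
      _ = (c * S' + ℓins * Δ + δ' * θ ^ k) * M.rHist k := by ring
  -- the relative displacement and its A-PRIORI budget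
  set ρ := ‖x₁ - x₀‖ / M.rOp k + ‖y₁ - y₀‖ / M.rHist k with hρ_def
  have hρx : 0 ≤ ‖x₁ - x₀‖ / M.rOp k := by positivity
  have hρy : 0 ≤ ‖y₁ - y₀‖ / M.rHist k := by positivity
  have hρβ : ρ ≤ (δ + δ') * θ ^ k + c * S' + (ℓop + ℓins) * Δ := by
    have h1 : ‖x₁ - x₀‖ / M.rOp k ≤ ℓop * Δ + δ * θ ^ k := by rw [div_le_iff₀ hrOp]; exact hxd
    have h2 : ‖y₁ - y₀‖ / M.rHist k ≤ c * S' + ℓins * Δ + δ' * θ ^ k := by rw [div_le_iff₀ hrHist]; exact hyd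
    have e : (δ + δ') * θ ^ k + c * S' + (ℓop + ℓins) * Δ
        = (ℓop * Δ + δ * θ ^ k) + (c * S' + ℓins * Δ + δ' * θ ^ k) := by ring
    rw [hρ_def, e]
    exact add_le_add h1 h2
  have hρS : ρ ≤ (δ + δ') * θ ^ k + c * S + (ℓop + ℓins) * Δ :=
    hρβ.trans (by nlinarith [mul_le_mul_of_nonneg_left hS'S hc])
  -- the two runs' outputs are the real parts of the step output at the two data points
  have hdisc : disc₂ EA EB gA gB U X ≤ ‖M.Out k x₁ y₁ X - M.Out k x₀ y₀ X‖ := by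
    have eA := hrA gA hgA U X
    have eB := hrB gB hgB U X
    rw [hX] at eA eB
    unfold disc₂
    rw [eA, eB, ← Complex.sub_re]
    exact Complex.abs_re_le_norm _
  -- bookkeeping of the history sum
  have hsum : ∑ j ∈ range k, Λ * c * ω ^ (k - j) * D j = Λ * c * S := by
    rw [hS, mul_sum]
    exact sum_congr rfl fun j _ => by ring
  have hS0 : 0 ≤ S := hS'0.trans hS'S
  have hℓΔ : 0 ≤ Λ * (ℓop + ℓins) * Δ := mul_nonneg (mul_nonneg hΛ hℓ) hΔ0
  by_cases hk : k < k₀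
  · -- FIRST SCALES: the one-run bounds, absorbed by the constant B
    calc disc₂ EA EB gA gB U X ≤ |EA gA (C.transport U) X| + |EB gB U X| := abs_sub _ _
      _ ≤ EA₀ * Real.exp (-(κ * C.d X)) + E₀ * Real.exp (-(κ * C.d X)) :=
          add_le_add (hdA gA hgA _ X) (hdB gB hgB U X)
      _ = (EA₀ + E₀) * Real.exp (-(κ * C.d X)) := by ring
      _ ≤ B * θ ^ k * Real.exp (-(κ * C.d X)) := mul_le_mul_of_nonneg_right (hfirst k hk) hexp.le
      _ ≤ ((Λ * (δ + δ') + B) * θ ^ k + Λ * (ℓop + ℓins) * Δ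
            + ∑ j ∈ range k, Λ * c * ω ^ (k - j) * D j) * Real.exp (-(κ * C.d X)) := by
          rw [hsum]
          apply mul_le_mul_of_nonneg_right _ hexp.le
          have h1 : 0 ≤ Λ * (δ + δ') * θ ^ k := mul_nonneg (mul_nonneg hΛ hδ) hθk
          have h2 : 0 ≤ Λ * c * S := mul_nonneg (mul_nonneg hΛ hc) hS0
          linarith
  · -- NEAR REGIME k ≥ k₀: each species is displaced by at most ρ₀ margins, and the Lipschitz bound applies
    have hk' : k₀ ≤ k := not_lt.mp hk
    have hθkk₀ : θ ^ k ≤ θ ^ k₀ := pow_le_pow_of_le_one hθ hθ1 hk'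
    have hρ1 : ρ ≤ ρ₀ :=
      calc ρ ≤ (δ + δ') * θ ^ k + c * S' + (ℓop + ℓins) * Δ := hρβ
        _ ≤ (δ + δ') * θ ^ k₀ + c * ((EA₀ + E₀) * (ω / (1 - ω))) + (ℓop + ℓins) * Γ :=
            add_le_add (add_le_add (mul_le_mul_of_nonneg_left hθkk₀ hδ) (mul_le_mul_of_nonneg_left hS'E hc))
              (mul_le_mul_of_nonneg_left hΔΓ hℓ)
        _ = (δ + δ') * θ ^ k₀ + c * (EA₀ + E₀) * (ω / (1 - ω)) + (ℓop + ℓins) * Γ := by ring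
        _ ≤ ρ₀ := hnear
    have hq1 : ‖x₁ - x₀‖ ≤ ρ₀ * M.rOp k := by
      have : ‖x₁ - x₀‖ / M.rOp k ≤ ρ₀ := (le_add_of_nonneg_right hρy).trans hρ1
      rwa [div_le_iff₀ hrOp] at this
    have hq2 : ‖y₁ - y₀‖ ≤ ρ₀ * M.rHist k := by
      have : ‖y₁ - y₀‖ / M.rHist k ≤ ρ₀ := (le_add_of_nonneg_left hρx).trans hρ1
      rwa [div_le_iff₀ hrHist] at this
    have h2 : ‖M.Out k x₁ y₁ X - M.Out k x₀ y₀ X‖ ≤ Λ * ρ * Real.exp (-(κ * C.d X)) :=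
      hlip k gB hgB U (M.dataB EB gB U k) (hbase k gB hgB U) X hX (x₁, y₁) hq1 hq2
    calc disc₂ EA EB gA gB U X ≤ _ := hdisc
      _ ≤ Λ * ρ * Real.exp (-(κ * C.d X)) := h2
      _ ≤ Λ * ((δ + δ') * θ ^ k + c * S + (ℓop + ℓins) * Δ) * Real.exp (-(κ * C.d X)) :=
          mul_le_mul_of_nonneg_right (mul_le_mul_of_nonneg_left hρS hΛ) hexp.le
      _ ≤ ((Λ * (δ + δ') + B) * θ ^ k + Λ * (ℓop + ℓins) * Δ
            + ∑ j ∈ range k, Λ * c * ω ^ (k - j) * D j) * Real.exp (-(κ * C.d X)) := by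
          rw [hsum]
          apply mul_le_mul_of_nonneg_right _ hexp.le
          have h1 : 0 ≤ B * θ ^ k := mul_nonneg hB hθk
          nlinarith

end Model

end Summit.QuantumFields.BalabanUV.T4Continuum.NE4TwoRunStepModel
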